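import Literature.MathematicalPhysics.QuantumLattice.HubbardDressedClusterEnergyFunctional
import Literature.MathematicalPhysics.QuantumLattice.FermionBoxProductEntropy
import Literature.MathematicalPhysics.QuantumLattice.FermionBoxProductMarginalsParts
import HarnessLib

/-!
# The seam-dressed cluster trial state on the square torus: density matrix, entropy `= K_x K_y · S(σ)`, and
# invariance under box translations

Topic `Literature/MathematicalPhysics/QuantumLattice` (namespace = path; family `hubbard`). The trial state of
certificate **C3** of the `T > 0` Hubbard programme on the square torus `FermionTorus 2 L`, `L = K_x a = K_y b`:

  `ρ' = W · (Π_v Γ_{box v} σ) · Wᴴ`,   `W = Π_{(g,v)} Γ_{gate (g,v)} u_g`,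

the product of ONE even box density matrix `σ` over all `K_x K_y` boxes (legs `SeamDressed.boxLeg`), dressed by one
layer of the separated, number-conserving gates (legs `SeamDressed.gateLegT`). We prove:

* `productState`, `gateLayer`, `trialState` and their algebra: `Wᴴ W = W Wᴴ = 𝟙`, `[N, W] = 0`;
* `posSemidef_trialState`, `trace_trialState` (`= 1`);
* **`vonNeumannEntropy_trialState`**: `S(ρ') = K_x K_y · S(σ)` for faithful `σ` (unitary invariance + additivity over
  the boxes, `vonNeumannEntropy_boxProd`);
* **box-translation invariance**: `T_{z(w)} ρ' = ρ'` (`relabel_translate_trialState`), hence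
  `tr(ρ' · T_{z(w)} X) = tr(ρ' X)` (`trace_trialState_mul_relabel_translate`);
* `trace_trialState_mul_totalNumber`: `tr(ρ' N) = K_x K_y · tr(σ N_box)`.

Everything is PROVED; the three definitions have bodies; no named fact.

## References

* M. Kliesch, C. Gogolin, M. J. Kastoryano, A. Riera, J. Eisert, Phys. Rev. X 4 (2014) 031019, §II. [cite: KlieschEtAl2014, §II]
* H. Araki, H. Moriya, Rev. Math. Phys. 15 (2003) 93, §4.3, §11.1 Thm. 11.2. [cite: ArakiMoriya2003, §11.1 Theorem 11.2]
* S. Friedli, Y. Velenik, *Statistical Mechanics of Lattice Systems* (2017), §3.1. [cite: FriedliVelenik2017, §3.1]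
-/

noncomputable section

namespace Literature.MathematicalPhysics.QuantumLattice

open Matrix Finset HubbardWave0 Literature.Probability.LatticeModels AndersonCluster ThermodynamicLimit
open scoped ComplexOrder BigOperators
open Literature.InformationTheory.Entropy (vonNeumannEntropy vonNeumannEntropy_unitary_conj)

namespace SeamDressed

section State

variable (a b : ℕ) [NeZero a] [NeZero b] (L : ℕ) [NeZero L] {Kx Ky : ℕ}
  (hLx : (L : ℤ) = Kx * a) (hLy : (L : ℤ) = Ky * b)
  {m : ℕ} (G : Fin m → Finset (Site 2)) (hG : ∀ g, G g ⊆ gateRange a b) (hK : 3 ≤ Kx ∧ 3 ≤ Ky)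
  (hsep : ∀ g g', ∀ x ∈ G g, ∀ x' ∈ G g', ((a : ℤ) ∣ x' 0 - x 0) → ((b : ℤ) ∣ x' 1 - x 1) → g = g' ∧ x = x')
  (u : ∀ g, FermionOp (G g)) (hu : ∀ g, parityAut (u g) = u g)
  (σ : FermionOp (rectWindow a b)) (hσ : parityAut σ = σ)

/-- (Local to this file.) Equality of torus sites is decided through the linear order — the instance the generic
Jordan–Wigner lemmas carry; without it the two coexisting `DecidableEq (FermionTorus 2 L)` paths make `relabel`
elaboration on the torus time out. [folklore] -/
noncomputable local instance (priority := high) instDecidableEqFermionTorusSeamDressedState : DecidableEq (FermionTorus 2 L) :=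
  LinearOrder.toDecidableEq

/-- **The box product state** `Π_v Γ_{box v} σ` on the torus. [cite: ArakiMoriya2003, §11.1 Theorem 11.2] -/
def productState : Matrix (Finset (Orb (FermionTorus 2 L))) (Finset (Orb (FermionTorus 2 L))) ℂ :=
  boxProd (disjoint_boxLeg a b L hLx hLy) (fun _ : Fin Kx × Fin Ky => σ) (fun _ => hσ) Finset.univ

/-- **The gate layer** `W = Π_{(g,v)} Γ_{gate (g,v)} u_g` on the torus (all box translates of the reference gates).
[cite: KlieschEtAl2014, §II] -/
def gateLayer : Matrix (Finset (Orb (FermionTorus 2 L))) (Finset (Orb (FermionTorus 2 L))) ℂ :=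
  boxProd (disjoint_gateLegT a b L hLx hLy G hG hK hsep) (fun k : Fin m × (Fin Kx × Fin Ky) => u k.1)
    (fun k => hu k.1) Finset.univ

/-- **The seam-dressed cluster trial state** `ρ' = W (Π_v Γ_{box v} σ) Wᴴ`. [cite: KlieschEtAl2014, §II] -/
def trialState : Matrix (Finset (Orb (FermionTorus 2 L))) (Finset (Orb (FermionTorus 2 L))) ℂ :=
  gateLayer a b L hLx hLy G hG hK hsep u hu * productState a b L hLx hLy σ hσ * (gateLayer a b L hLx hLy G hG hK hsep u hu)ᴴ

variable (huU : ∀ g, (u g)ᴴ * u g = 1)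
include huU

/-- `Wᴴ W = 𝟙`. [cite: BratteliRobinsonII1997, §5.2.2] -/
theorem conjTranspose_gateLayer_mul_self :
    (gateLayer a b L hLx hLy G hG hK hsep u hu)ᴴ * gateLayer a b L hLx hLy G hG hK hsep u hu = 1 := by
  rw [gateLayer]
  exact conjTranspose_boxProd_mul_self (disjoint_gateLegT a b L hLx hLy G hG hK hsep) (fun k => hu k.1)
    (fun k => huU k.1) Finset.univ

/-- `W Wᴴ = 𝟙`. [cite: BratteliRobinsonII1997, §5.2.2] -/
theorem gateLayer_mul_conjTranspose_self :
    gateLayer a b L hLx hLy G hG hK hsep u hu * (gateLayer a b L hLx hLy G hG hK hsep u hu)ᴴ = 1 := by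
  rw [gateLayer]
  exact boxProd_mul_conjTranspose_self (disjoint_gateLegT a b L hLx hLy G hG hK hsep) (fun k => hu k.1)
    (fun k => mul_eq_one_comm.1 (huU k.1)) Finset.univ

/-- `W` is unitary. [cite: BratteliRobinsonII1997, §5.2.2] -/
theorem gateLayer_mem_unitaryGroup :
    gateLayer a b L hLx hLy G hG hK hsep u hu ∈ Matrix.unitaryGroup (Finset (Orb (FermionTorus 2 L))) ℂ := by
  rw [gateLayer]
  exact boxProd_mem_unitaryGroup (disjoint_gateLegT a b L hLx hLy G hG hK hsep) (fun k => hu k.1) (fun k => huU k.1)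
    Finset.univ

omit [NeZero a] [NeZero b] huU in
/-- **The product state is a density matrix**: positive semidefinite … [cite: ArakiMoriya2003, §11.1 Theorem 11.2] -/
theorem posSemidef_productState (hσp : σ.PosSemidef) : (productState a b L hLx hLy σ hσ).PosSemidef := by
  rw [productState]
  exact posSemidef_boxProd (disjoint_boxLeg a b L hLx hLy) (fun _ => hσ) (fun _ => hσp) Finset.univ

omit [NeZero a] [NeZero b] huU in
/-- … of trace one (the boxes tile the torus). [cite: ArakiMoriya2003, §11.1 Theorem 11.2] -/
theorem trace_productState (hσtr : σ.trace = 1) : (productState a b L hLx hLy σ hσ).trace = 1 := by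
  rw [productState]
  exact trace_boxProd_univ_eq_one (disjoint_boxLeg a b L hLx hLy) (fun _ => hσ) (fun _ => hσtr)
    (sum_card_box_eq_card_torus a b L hLx hLy)

omit huU in
/-- **The trial state is positive semidefinite.** [cite: KlieschEtAl2014, §II] -/
theorem posSemidef_trialState (hσp : σ.PosSemidef) : (trialState a b L hLx hLy G hG hK hsep u hu σ hσ).PosSemidef := by
  rw [trialState]
  exact (posSemidef_productState a b L hLx hLy σ hσ hσp).mul_mul_conjTranspose_same _

/-- **The trial state has trace one.** [cite: KlieschEtAl2014, §II] -/
theorem trace_trialState (hσtr : σ.trace = 1) : (trialState a b L hLx hLy G hG hK hsep u hu σ hσ).trace = 1 := by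
  rw [trialState, Matrix.trace_mul_cycle, conjTranspose_gateLayer_mul_self a b L hLx hLy G hG hK hsep u hu huU,
    Matrix.one_mul, trace_productState a b L hLx hLy σ hσ hσtr]

/-- **Entropy of the trial state**: `S(ρ') = K_x K_y · S(σ)` for a faithful box state — unitary invariance and
additivity of the von Neumann entropy over the boxes. [cite: NielsenChuang2010, §11.3.4 eq. (11.58)] -/
theorem vonNeumannEntropy_trialState (hσpd : σ.PosDef) (hσtr : σ.trace = 1) :
    vonNeumannEntropy (trialState a b L hLx hLy G hG hK hsep u hu σ hσ) = ((Kx * Ky : ℕ) : ℝ) * vonNeumannEntropy σ := by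
  rw [trialState, vonNeumannEntropy_unitary_conj (gateLayer_mem_unitaryGroup a b L hLx hLy G hG hK hsep u hu huU)
    (posSemidef_productState a b L hLx hLy σ hσ hσpd.posSemidef).1, productState,
    vonNeumannEntropy_boxProd (disjoint_boxLeg a b L hLx hLy) (fun _ => hσ) (fun _ => hσpd) (fun _ => hσtr)
      (sum_card_box_eq_card_torus a b L hLx hLy),
    Finset.sum_const, Finset.card_univ, Fintype.card_prod, Fintype.card_fin, Fintype.card_fin, nsmul_eq_mul]

/-! ### Box-translation invariance -/

omit huU in
/-- Re-indexing a box product over `univ` along a permutation of the index type. [folklore] -/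
private theorem boxProd_univ_reindex {Λ : Type*} [LinearOrder Λ] [Fintype Λ] {K : Type*} [Fintype K] [DecidableEq K]
    {Λ₀ : K → Type*} [∀ k, LinearOrder (Λ₀ k)] [∀ k, Fintype (Λ₀ k)] {φ : ∀ k, Λ₀ k ↪ Λ}
    (hφ : ∀ k j, k ≠ j → Disjoint ((Finset.univ : Finset (Λ₀ k)).map (φ k)) ((Finset.univ : Finset (Λ₀ j)).map (φ j)))
    {c : ∀ k, Matrix (Finset (Orb (Λ₀ k))) (Finset (Orb (Λ₀ k))) ℂ} (hc : ∀ k, parityAut (c k) = c k)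
    (e : K ≃ K) (f : K → Matrix (Finset (Orb Λ)) (Finset (Orb Λ)) ℂ)
    (hf : ∀ k, f k = fermionEmbed (φ (e k)) (c (e k)))
    (comm : ((Finset.univ : Finset K) : Set K).Pairwise fun k j => Commute (f k) (f j)) :
    Finset.univ.noncommProd f comm = boxProd hφ c hc Finset.univ := by
  symm
  rw [boxProd, Finset.noncommProd_congr (Finset.map_univ_equiv e).symm (fun _ _ => rfl)
      (fun k _ j _ hkj => commute_fermionEmbed_box_of_parityAut_eq hφ hkj (hc _) _),
    noncommProd_map_of_embedding]
  exact Finset.noncommProd_congr rfl (fun k _ => (hf k).symm) _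

omit huU in
/-- A torus translation is the second quantisation of the translated identity leg: `T_c X = Γ_{x ↦ x + c} X`.
[cite: ArakiMoriya2003, §4.1 Def. 4.3] -/
theorem relabel_translate_eq_fermionEmbed (c : TorusSite 2 L)
    (X : Matrix (Finset (Orb (FermionTorus 2 L))) (Finset (Orb (FermionTorus 2 L))) ℂ) :
    relabel (Orb.translate c) X = fermionEmbed (FermionTorus.ofTorusEquiv (Equiv.addRight c)).toEmbedding X := by
  rw [fermionEmbed_equiv]
  rfl

omit [NeZero a] [NeZero b] huU in
include hK in
/-- **The product state is invariant under box translations**: `T_{z(w)} (Π_v Γ_{box v} σ) = Π_v Γ_{box v} σ`.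
[cite: FriedliVelenik2017, §3.1] -/
theorem relabel_translate_productState (w : Fin Kx × Fin Ky) :
    relabel (Orb.translate (Torus.proj L (boxVec a b w))) (productState a b L hLx hLy σ hσ) =
      productState a b L hLx hLy σ hσ := by
  haveI : NeZero Kx := ⟨by have := hK.1; omega⟩
  haveI : NeZero Ky := ⟨by have := hK.2; omega⟩
  rw [relabel_translate_eq_fermionEmbed, productState, fermionEmbed_boxProd _ _ _ Finset.univ, boxProd]
  refine boxProd_univ_reindex (disjoint_boxLeg a b L hLx hLy) (fun _ => hσ) (Equiv.addRight w) _ (fun v => ?_) _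
  refine congrFun (congrArg DFunLike.coe (fermionEmbed_congr fun y => ?_)) σ
  show FermionTorus.ofTorusEquiv (Equiv.addRight (Torus.proj L (boxVec a b w))) (torusPt L (ofLex y.1 + boxVec a b v)) =
    torusPt L (ofLex y.1 + boxVec a b (v + w))
  simp only [torusPt, FermionTorus.ofTorusEquiv_ofTorusSite, Equiv.coe_addRight, proj_add,
    proj_boxVec_add a b L hLx hLy, add_assoc]

omit huU in
/-- **The gate layer is invariant under box translations.** [cite: FriedliVelenik2017, §3.1] -/
theorem relabel_translate_gateLayer (w : Fin Kx × Fin Ky) :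
    relabel (Orb.translate (Torus.proj L (boxVec a b w))) (gateLayer a b L hLx hLy G hG hK hsep u hu) =
      gateLayer a b L hLx hLy G hG hK hsep u hu := by
  haveI : NeZero Kx := ⟨by have := hK.1; omega⟩
  haveI : NeZero Ky := ⟨by have := hK.2; omega⟩
  rw [relabel_translate_eq_fermionEmbed, gateLayer, fermionEmbed_boxProd _ _ _ Finset.univ, boxProd]
  refine boxProd_univ_reindex (disjoint_gateLegT a b L hLx hLy G hG hK hsep) (fun k => hu k.1)
    ((Equiv.refl (Fin m)).prodCongr (Equiv.addRight w)) _ (fun k => ?_) _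
  refine congrFun (congrArg DFunLike.coe (fermionEmbed_congr fun y => ?_)) (u k.1)
  show FermionTorus.ofTorusEquiv (Equiv.addRight (Torus.proj L (boxVec a b w))) (torusPt L (ofLex y.1 + boxVec a b k.2)) =
    torusPt L (ofLex y.1 + boxVec a b (k.2 + w))
  simp only [torusPt, FermionTorus.ofTorusEquiv_ofTorusSite, Equiv.coe_addRight, proj_add,
    proj_boxVec_add a b L hLx hLy, add_assoc]

omit huU in
/-- **The trial state is invariant under box translations.** [cite: FriedliVelenik2017, §3.1] -/
theorem relabel_translate_trialState (w : Fin Kx × Fin Ky) :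
    relabel (Orb.translate (Torus.proj L (boxVec a b w))) (trialState a b L hLx hLy G hG hK hsep u hu σ hσ) =
      trialState a b L hLx hLy G hG hK hsep u hu σ hσ := by
  rw [trialState, map_mul, map_mul, relabel_conjTranspose, relabel_translate_gateLayer,
    relabel_translate_productState a b L hLx hLy hK σ hσ w]

omit huU in
/-- **Translated observables have the same expectation** in the box-translation invariant trial state:
`tr(ρ' · T_{z(w)} X) = tr(ρ' X)`. [cite: FriedliVelenik2017, §3.1] -/
theorem trace_trialState_mul_relabel_translate (w : Fin Kx × Fin Ky)
    (X : Matrix (Finset (Orb (FermionTorus 2 L))) (Finset (Orb (FermionTorus 2 L))) ℂ) :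
    (trialState a b L hLx hLy G hG hK hsep u hu σ hσ * relabel (Orb.translate (Torus.proj L (boxVec a b w))) X).trace =
      (trialState a b L hLx hLy G hG hK hsep u hu σ hσ * X).trace := by
  conv_lhs => rw [← relabel_translate_trialState a b L hLx hLy G hG hK hsep u hu σ hσ w, ← map_mul, trace_relabel]

/-! ### The particle number -/

omit huU in
/-- `[N, W] = 0` for number-conserving gates. [cite: BratteliRobinsonII1997, §5.2.2] -/
theorem commute_totalNumber_gateLayer (huN : ∀ g, Commute totalNumber (u g)) :
    Commute totalNumber (gateLayer a b L hLx hLy G hG hK hsep u hu) := by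
  have h := commute_totalNumber_boxProd (disjoint_gateLegT a b L hLx hLy G hG hK hsep) (a := fun k => u k.1)
    (fun k => huN k.1) Finset.univ
  rw [gateLayer]
  exact h

omit huU in
/-- `tr(W ρ Wᴴ N) = tr(ρ N)` for `Wᴴ W = 𝟙` and `[N, W] = 0`. [folklore] -/
private theorem trace_conj_mul_of_commute {n : Type*} [Fintype n] [DecidableEq n] (W ρ N : Matrix n n ℂ)
    (hW : Wᴴ * W = 1) (hcomm : N * W = W * N) : (W * ρ * Wᴴ * N).trace = (ρ * N).trace := by
  rw [Matrix.mul_assoc, Matrix.mul_assoc, Matrix.trace_mul_comm, Matrix.mul_assoc, Matrix.mul_assoc, hcomm,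
    ← Matrix.mul_assoc Wᴴ, hW, Matrix.one_mul]

omit [NeZero a] [NeZero b] huU in
/-- **`tr(ρ N) = K_x K_y · tr(σ N_box)`** for the product state: every box carries `σ`.
[cite: ArakiMoriya2003, §11.1 Theorem 11.2] -/
theorem trace_productState_mul_totalNumber (hσtr : σ.trace = 1) :
    (productState a b L hLx hLy σ hσ * totalNumber).trace =
      ((Kx * Ky : ℕ) : ℂ) * (σ * (totalNumber : FermionOp (rectWindow a b))).trace := by
  have hN : (totalNumber : Matrix (Finset (Orb (FermionTorus 2 L))) (Finset (Orb (FermionTorus 2 L))) ℂ) =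
      ∑ v : Fin Kx × Fin Ky, ∑ y : PolySite (rectWindow a b),
        fermionEmbed (boxLeg a b L hLx hLy v) (numberOp y 0 + numberOp y 1) := by
    rw [← sum_torusDensity_eq_totalNumber, sum_torusSite_eq_sum_boxes a b L hLx hLy]
    refine Finset.sum_congr rfl fun v _ => Finset.sum_congr rfl fun y _ => ?_
    rw [map_add, fermionEmbed_numberOp, fermionEmbed_numberOp, boxLeg_apply, torusDensity, torusPt]
  have h2 := congrArg (fun X => (productState a b L hLx hLy σ hσ * X).trace) hN
  simp only [Finset.mul_sum, Matrix.trace_sum] at h2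
  have h3 : ∀ (v : Fin Kx × Fin Ky) (y : PolySite (rectWindow a b)),
      (productState a b L hLx hLy σ hσ * fermionEmbed (boxLeg a b L hLx hLy v) (numberOp y 0 + numberOp y 1)).trace =
        (σ * (numberOp y 0 + numberOp y 1)).trace := by
    intro v y
    rw [productState]
    exact trace_boxProd_mul_fermionEmbed (disjoint_boxLeg a b L hLx hLy) (fun _ => hσ) (fun _ => hσtr)
      (sum_card_box_eq_card_torus a b L hLx hLy) v _
  rw [h2, Finset.sum_congr rfl fun v _ => Finset.sum_congr rfl fun y _ => h3 v y, Finset.sum_const, Finset.card_univ,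
    Fintype.card_prod, Fintype.card_fin, Fintype.card_fin, nsmul_eq_mul]
  have h4 : ∑ y : PolySite (rectWindow a b), (σ * (numberOp y 0 + numberOp y 1)).trace =
      (σ * (totalNumber : FermionOp (rectWindow a b))).trace := by
    rw [totalNumber, Finset.mul_sum, Matrix.trace_sum]
    exact Finset.sum_congr rfl fun y _ => by rw [Fin.sum_univ_two]
  rw [h4]

/-- **`tr(ρ' N) = K_x K_y · tr(σ N_box)`**: the gates conserve the particle number and every box carries `σ`.
[cite: KlieschEtAl2014, §II] -/
theorem trace_trialState_mul_totalNumber (huN : ∀ g, Commute totalNumber (u g)) (hσtr : σ.trace = 1) :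
    (trialState a b L hLx hLy G hG hK hsep u hu σ hσ * totalNumber).trace =
      ((Kx * Ky : ℕ) : ℂ) * (σ * (totalNumber : FermionOp (rectWindow a b))).trace := by
  have hW := conjTranspose_gateLayer_mul_self a b L hLx hLy G hG hK hsep u hu huU
  have hcomm := (commute_totalNumber_gateLayer a b L hLx hLy G hG hK hsep u hu huN).eq
  rw [← trace_productState_mul_totalNumber a b L hLx hLy σ hσ hσtr, trialState]
  exact trace_conj_mul_of_commute _ _ _ hW hcomm

end State

end SeamDressed

end Literature.MathematicalPhysics.QuantumLattice

end
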